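import Literature.NumberTheory.GaloisRepresentations.LocalKroneckerWeberInertiaProofs
import Literature.NumberTheory.EllipticCurves.ZpExtension
import Literature.NumberTheory.EllipticCurves.Sha
import HarnessLib

/-!
# The decomposition group at `p` surjects onto `Gal(ℚ_∞/ℚ)`: local lifts of a topological
# generator of the cyclotomic `ℤ_p`-extension (proofs only)

Topic `Literature/NumberTheory/EllipticCurves` (Iwasawa theory of `ℤ_p`-extensions), `Proofs` file
(theorems only: no definition, no named fact, no instance). For a prime `p`, the cyclotomic
`ℤ_p`-extension `κ : Γ_ℚ →ₜ* ℤ_p` of `ℚ` (`ZpExtension.IsCyclotomic`: `ker κ = χ_p⁻¹(μ(ℤ_p))`) and the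
place `v` of `ℚ` above `p` (`(p : 𝓞 ℚ) ∈ v.asIdeal`, completion `ℚ_v = v.adicCompletion ℚ`, chosen
embedding `closureEmb ℚ_v : ℚ̄ → ℚ̄_v` with restriction `resGalOfEmb (closureEmb ℚ_v) : Γ_{ℚ_v} → Γ_ℚ`):

* `ZpExtension.IsCyclotomic.exists_apply_resGalOfEmb_adicCompletion_eq` — **`κ ∘ res` is onto**:
  every `t ∈ ℤ_p` is `κ(res g)` for some `g ∈ Γ_{ℚ_v}` (indeed some `g` in the inertia group); i.e.
  the decomposition group of `v` in `Gal(ℚ_∞/ℚ) ≃ ℤ_p` is everything — "`p` is totally ramified in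
  `ℚ_∞/ℚ`" (Washington, Prop. 13.2's setting; Kobayashi 2003 §2: "the prime `p` is totally ramified
  in `K_n`"; Sprung 2012 p. 1486: "`𝔭` the prime of `ℚ_∞` above `p`").
* `ZpExtension.IsCyclotomic.exists_isTopGenerator_resGalOfEmb_adicCompletion` — in particular the
  normalised topological generator is a restriction: `∃ g ∈ Γ_{ℚ_v}, κ(res g) = 1`
  (`κ.IsTopGenerator (resGalOfEmb (closureEmb ℚ_v) g)`), the local element `g` through which the
  cyclotomic tower's local objects are formed (Kobayashi's / Sprung's `G_n` acting on `E(k_n)`; the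
  binder `hlift` / `hg` of `Sprung2012.thm22_exists_isHondaSystem`, `Sprung2024.sec52_…`,
  `Sprung2024.lem59_…`, `Sprung2012.thm12_…` and of the route file
  `Summits/…/SignedLowerHalvesSprungLowerHalfAtThreeKDotSplitReal.lean`).

Proof: `χ_p(I_{ℚ_v}) = ℤ_pˣ` (tree theorem
`adicCompletion_rat_exists_mem_absInertia_cyclotomicCharacter_eq`, Serre *Local Fields* IV §4
Prop. 17: `ℚ_p(μ_{p^∞})/ℚ_p` totally ramified), `χ_p ∘ res = χ_p` (`cyclotomicCharacter_absGaloisRestrict`;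
`resGalOfEmb (closureEmb ℚ_v) = absGaloisRestrict ℚ ℚ_v` definitionally), and `ker χ_p ≤ ker κ`
(definition of `IsCyclotomic`): for `σ ∈ Γ_ℚ` with `κ σ = t` pick `g` with `χ_p(g) = χ_p(σ)`; then
`res(g)·σ⁻¹ ∈ ker χ_p ≤ ker κ`, so `κ(res g) = κ σ = t`. Nothing about elliptic curves is used.
HONEST FRAMING (cell `bsd-ssimc`, seat `bsd-ssimc-k3c5-kdot-split` g3, crux
stmt-BirchSwinnertonDyer-19003): discharges the displayed folklore binder `hlift` of the crux-5 helper
file; closes nothing; BSD is not proved by any of this.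

References: L. Washington, *Introduction to Cyclotomic Fields* (2nd ed. 1997), §13.1 and Prop. 13.2
(setting); J.-P. Serre, *Local Fields* (1979), Ch. IV §4 Prop. 17; S. Kobayashi, Invent. Math. 152
(2003), §2 p. 4; F. Sprung, J. Number Theory 132 (2012), p. 1486.
-/

noncomputable section

open scoped NumberField

open Field IsDedekindDomain Literature.NumberTheory.GaloisRepresentations

namespace Literature.NumberTheory.EllipticCurves

namespace ZpExtension.IsCyclotomic

variable {p : ℕ} [Fact p.Prime] {κ : ZpExtension ℚ p}

/-- **The decomposition group at `p` surjects onto `Gal(ℚ_∞/ℚ) ≃ ℤ_p`** ("`p` is totally ramified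
in the cyclotomic `ℤ_p`-extension"): for the cyclotomic `κ` and the place `v ∣ p` of `ℚ`, every
`t ∈ ℤ_p` is `κ(res g)` for some `g` in the inertia group of `Γ_{ℚ_v}`, `res = resGalOfEmb (closureEmb ℚ_v)`.
From `χ_p(I_{ℚ_v}) = ℤ_pˣ` (`adicCompletion_rat_exists_mem_absInertia_cyclotomicCharacter_eq`),
`χ_p ∘ res = χ_p` and `ker χ_p ≤ ker κ`.
[cite: Washington1997, §13.1] -/
theorem exists_mem_absInertia_apply_resGalOfEmb_adicCompletion_eq (hκ : κ.IsCyclotomic)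
    (v : HeightOneSpectrum (𝓞 ℚ)) (hv : (p : 𝓞 ℚ) ∈ v.asIdeal) (t : Multiplicative ℤ_[p]) :
    ∃ g ∈ absInertia (v.adicCompletion ℚ),
      κ (resGalOfEmb (closureEmb (K := ℚ) (v.adicCompletion ℚ)) g) = t := by
  have hp : p.Prime := Fact.out
  haveI : NeZero (p : ℚ) := ⟨Nat.cast_ne_zero.mpr hp.ne_zero⟩
  -- `primesEquiv v = p`
  have hv' : (Rat.HeightOneSpectrum.primesEquiv v : ℕ) = p := by
    have h1 : Rat.HeightOneSpectrum.natGenerator v ∣ p := by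
      rw [Rat.HeightOneSpectrum.natGenerator_dvd_iff, Ideal.mem_map_of_equiv]
      exact ⟨p, hv, map_natCast _ p⟩
    exact (Nat.prime_dvd_prime_iff_eq (Rat.HeightOneSpectrum.prime_natGenerator v) hp).mp h1
  -- a global element with `κ σ = t`, and a local inertia element with the same cyclotomic character
  obtain ⟨σ, hσ⟩ := κ.surjective t
  obtain ⟨g, hgI, hg⟩ := adicCompletion_rat_exists_mem_absInertia_cyclotomicCharacter_eq p v hv'
    (GaloisRep.cyclotomicCharacter ℚ p σ)
  refine ⟨g, hgI, ?_⟩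
  -- `χ_p (res g) = χ_p g = χ_p σ`
  have hres : GaloisRep.cyclotomicCharacter ℚ p
      (resGalOfEmb (closureEmb (K := ℚ) (v.adicCompletion ℚ)) g) =
        GaloisRep.cyclotomicCharacter ℚ p σ := by
    rw [← hg]
    exact cyclotomicCharacter_absGaloisRestrict ℚ (v.adicCompletion ℚ) p g
  -- hence `res g · σ⁻¹ ∈ ker χ_p ≤ χ_p⁻¹(μ(ℤ_p)) = ker κ`
  have hmem : resGalOfEmb (closureEmb (K := ℚ) (v.adicCompletion ℚ)) g * σ⁻¹ ∈ κ.kerSubgroup := by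
    have h : resGalOfEmb (closureEmb (K := ℚ) (v.adicCompletion ℚ)) g * σ⁻¹ ∈
        (CommGroup.torsion ℤ_[p]ˣ).comap (GaloisRep.cyclotomicCharacter ℚ p).toMonoidHom := by
      rw [Subgroup.mem_comap]
      change GaloisRep.cyclotomicCharacter ℚ p (_ * σ⁻¹) ∈ CommGroup.torsion ℤ_[p]ˣ
      rw [map_mul, map_inv, hres, mul_inv_cancel]
      exact one_mem _
    unfold ZpExtension.IsCyclotomic at hκ
    rw [hκ]
    exact h
  have hq : κ (resGalOfEmb (closureEmb (K := ℚ) (v.adicCompletion ℚ)) g * σ⁻¹) = 1 :=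
    ZpExtension.mem_kerSubgroup.mp hmem
  rw [map_mul, map_inv, mul_inv_eq_one] at hq
  rw [hq]
  exact hσ

/-- **`κ ∘ res : Γ_{ℚ_v} → ℤ_p` is onto** for the cyclotomic `ℤ_p`-extension `κ` of `ℚ` and the
place `v ∣ p` (the decomposition group of the prime above `p` in `Gal(ℚ_∞/ℚ)` is the whole group).
[cite: Washington1997, §13.1] -/
theorem exists_apply_resGalOfEmb_adicCompletion_eq (hκ : κ.IsCyclotomic)
    (v : HeightOneSpectrum (𝓞 ℚ)) (hv : (p : 𝓞 ℚ) ∈ v.asIdeal) (t : Multiplicative ℤ_[p]) :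
    ∃ g : absoluteGaloisGroup (v.adicCompletion ℚ),
      κ (resGalOfEmb (closureEmb (K := ℚ) (v.adicCompletion ℚ)) g) = t := by
  obtain ⟨g, -, hg⟩ := hκ.exists_mem_absInertia_apply_resGalOfEmb_adicCompletion_eq v hv t
  exact ⟨g, hg⟩

/-- **A local lift of the topological generator**: for the cyclotomic `ℤ_p`-extension `κ` of `ℚ`
and the place `v ∣ p` there is `g ∈ Γ_{ℚ_v}` whose restriction `res g ∈ Γ_ℚ` is a normalised
topological generator, `κ(res g) = 1` (`κ.IsTopGenerator (resGalOfEmb (closureEmb ℚ_v) g)`) — the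
local element through which `G_n = Gal(k_n/ℚ_p) = Gal(ℚ_n/ℚ)` acts in Kobayashi's and Sprung's local
constructions (the binder `hg`/`hlift` of `Sprung2012.thm22_exists_isHondaSystem` and its users).
[cite: Kobayashi2003, §2 p. 4 ("the prime p is totally ramified in K_n")] -/
theorem exists_isTopGenerator_resGalOfEmb_adicCompletion (hκ : κ.IsCyclotomic)
    (v : HeightOneSpectrum (𝓞 ℚ)) (hv : (p : 𝓞 ℚ) ∈ v.asIdeal) :
    ∃ g : absoluteGaloisGroup (v.adicCompletion ℚ),
      κ.IsTopGenerator (resGalOfEmb (closureEmb (K := ℚ) (v.adicCompletion ℚ)) g) :=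
  hκ.exists_apply_resGalOfEmb_adicCompletion_eq v hv (Multiplicative.ofAdd 1)

end ZpExtension.IsCyclotomic

end Literature.NumberTheory.EllipticCurves

end
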